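import Mathlib
import HarnessLib
import Summits.Langlands.Langlands.Theses.KleinTorsionDoor
import Literature.NumberTheory.Automorphic.CompletedCohomologyHeckeAlgebraGLn

/-!
# Birth skeleton (BC3) for crux stmt-Langlands-14194
`Summit.Langlands.Langlands.Theses.KleinTorsionDoor.ArtinTorsionClassicalityGL3` — line `birth`

Route `route-Langlands-KleinTorsionDoor` (`closes : ResidualSymSquareTorsionDoor →
SeptadicTorsionOccurrence → ArtinTorsionClassicalityGL3 → KleinArtinJunction → Langlands`).  The
crux (rank 3, card crux β, "Artin-weight torsion classicality on GL₃/ℚ") says: for `ι : ℚ̄₇ ≃ ℂ`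
and an irreducible, finite-image, odd-type `σ : Γ_ℚ → GL₃(ℂ)`, if for EVERY `s ≥ 1` the eigensystem
of `ι⁻¹σ` mod `7^s` is a point of the Hecke algebra of some `H^i(Γ₁(N_s) ⊂ SL₃(ℤ), 𝒪/7^s)` (with
the Frobenius congruences mod `7^s` away from `N_s`), then `σ` is automorphic (L-algebraic cuspidal
`π` on `GL₃(𝔸_ℚ)`, Satake = Frobenius a.e.).

This file is the skeleton that concludes the crux BY NAME from three named stubs, cut along the
three mathematically separate passages of any envisaged proof (the route header's two-layer plan
"EigenvarietyMembership → ArtinPointIsClassical", with the membership step split into its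
level-control and its comparison/limit halves):

* `stub_tameLevelControl` — TAME LEVEL CONTROL: the levels `N_s` of the hypothesis may be frozen
  to `N₀ · 7^{r_s}` for one `N₀ > 0` (torsion level-lowering for `GL₃/ℚ` at every depth; open in
  the level aspect, the natural target of the route's Voronoi/sharbly computation).
* `stub_completedCohomologyPoint` — COMPARISON AND PASSAGE TO THE LIMIT: fixed-tame-level
  occurrence at all depths (in the crux's `SL₃(ℤ)` vocabulary) makes `σ` `ι`-PRO-AUTOMORPHIC of some
  `S`-good tame level `𝒰`: a continuous `ℚ̄₇`-point of the tree's CONSTRUCTED big Hecke algebra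
  `CompletedCohomologyHeckeAlgebraGLn 𝒰` with which `σ` is associated through `ι`
  (`IsIotaProAutomorphic`; strong approximation `SL₃(ℤ) ↔ X_U` with the `det ≡ 1 mod 4` trick,
  Hochschild–Serre nilpotence from `K₁(7^r)` to the principal tower, flat base change, continuity;
  size L, provable in principle).
* `stub_artinPointClassical` — THE WALL: an irreducible finite-image odd `σ` that is
  `ι`-pro-automorphic of some tame level is automorphic (Fontaine–Mazur-type classicality at the
  non-cohomological weight `(0,0,0) = −ρ` on `GL₃/ℚ`; open problem; the GL₂ analogue is weight-one
  classicality of pro-modular points).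

Shape (for `ledger skeleton check`): §0 names the crux's clauses as `def`s (VERBATIM sub-terms of
the route decl, `𝒪` being notation; `crux_iff` is `Iff.rfl`, which certifies it); §1 is the one new
notion (`IsIotaProAutomorphic`, over the tree's `BigHeckeGLn.TameLevel` /
`CompletedCohomologyHeckeAlgebraGLn` / `TameLevel.heckeT` / `BigHeckeGLn.heckeFrobPoly`); each stub
is `theorem stub_<name> (binders) : <conclusion> := by sorry`; `_Goal.stub_<name> : Prop :=
type_of% @stub_<name>` names that statement; the composition
`ArtinTorsionClassicalityGL3_of (h₁ : _Goal.stub_tameLevelControl)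
(h₂ : _Goal.stub_completedCohomologyPoint) (h₃ : _Goal.stub_artinPointClassical) :
ArtinTorsionClassicalityGL3` is proved without `sorry` and concludes the route decl BY NAME; the
last `example` feeds the three stubs to it.

Disproof used: none — `ledger crux ls stmt-Langlands-14194` shows no `Disproof.lean`, the item has no
stub-false / line-dead notes, and `ledger negatives --problem Langlands` has no entry on this crux
(2026-08-17).  Vocabulary note: `CompletedCohomologyHeckeAlgebraGLn` is used as re-coned on
2026-08-17 (module docstring "Import discipline": no unproved named fact in its cone; the two
existence facts live in the leaf `…GLnFacts`, not imported here).  BC3 probes (planner folder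
`bc/probes.lean`): for each stub, `stub → ArtinTorsionClassicalityGL3` and `stub → Langlands` by
`exact?` and by `first | simpa | (unfold; simpa) | aesop` FAIL (rc and messages in NOTES.md).
-/

set_option linter.dupNamespace false

noncomputable section

namespace Summit.Langlands.Langlands.Cruxes.ArtinTorsionClassicalityGL3.Birth

open Summit.Langlands.Langlands.Theses.KleinTorsionDoor
open scoped BigOperators Topology Manifold Classical MeasureTheory ProbabilityTheory Matrix InnerProductSpace ComplexConjugate ContinuousMap
open Filter Set Function TopologicalSpace MeasureTheory
open Literature.NumberTheory.GaloisRepresentations Literature.NumberTheory.Automorphic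

-- `𝒪 = 𝒪_{ℚ̄₇}`: the valuation ring of `PadicAlgCl 7` (the crux's coefficient ring), as notation so
-- that every clause below is a VERBATIM sub-term of the route decl.
set_option quotPrecheck false in
local notation "𝒪" => ↥(Valued.v (R := PadicAlgCl 7)).valuationSubring

/-! ## 0. Named copies of the crux's clauses (verbatim sub-terms; `crux_iff` below is `Iff.rfl`) -/

/-- Hypothesis clause (i) of the crux at depth `s`, level `N`, degree `i`, values `(a, ε)`:
**Hecke-algebra-sense occurrence mod `7^s`** — the assignment `T(ℓ,k) ↦ a(ℓ,k)` (`ℓ ∤ N` prime,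
`k ≤ 3`), `⟨d⟩ ↦ ε(d)` kills every (non-commutative) polynomial relation among these operators on
`H^i(Γ₁(N) ⊂ SL₃(ℤ), 𝒪/7^s)`, i.e. extends to an algebra homomorphism from the Hecke algebra they
generate to `𝒪/7^s` (verbatim sub-term of `ArtinTorsionClassicalityGL3`; tree vocabulary
`SLn.heckeT`, `SLn.diamondOp` of `TorsionHeckeEigensystem`). [cite: Scholze2015, §V.4] -/
def IsHeckePointAtDepth [Fact (Nat.Prime 7)] (s N i : ℕ) (a : ℕ → ℕ → 𝒪) (ε : (ZMod N)ˣ → 𝒪) :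
    Prop :=
  ∀ F : FreeAlgebra (𝒪 ⧸ Ideal.span {((7 : 𝒪) ^ s)}) ({lk : ℕ × ℕ // Nat.Prime lk.1 ∧ ¬ lk.1 ∣ N ∧ lk.2 ≤ 3} ⊕ (ZMod N)ˣ), FreeAlgebra.lift (𝒪 ⧸ Ideal.span {((7 : 𝒪) ^ s)}) (Sum.elim (fun lk : {lk : ℕ × ℕ // Nat.Prime lk.1 ∧ ¬ lk.1 ∣ N ∧ lk.2 ≤ 3} => Literature.NumberTheory.Automorphic.SLn.heckeT 3 (Literature.NumberTheory.Automorphic.SLn.Gamma1 3 N) (𝒪 ⧸ Ideal.span {((7 : 𝒪) ^ s)}) i lk.1.1 lk.1.2) (fun d : (ZMod N)ˣ => Literature.NumberTheory.Automorphic.SLn.diamondOp 3 N (𝒪 ⧸ Ideal.span {((7 : 𝒪) ^ s)}) i (d : ZMod N))) F = 0 → FreeAlgebra.lift (𝒪 ⧸ Ideal.span {((7 : 𝒪) ^ s)}) (Sum.elim (fun lk : {lk : ℕ × ℕ // Nat.Prime lk.1 ∧ ¬ lk.1 ∣ N ∧ lk.2 ≤ 3} => Ideal.Quotient.mk (Ideal.span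 {((7 : 𝒪) ^ s)}) (a lk.1.1 lk.1.2)) (fun d : (ZMod N)ˣ => Ideal.Quotient.mk (Ideal.span {((7 : 𝒪) ^ s)}) (ε d))) F = 0

/-- Hypothesis clause (ii) of the crux at depth `s`, level `N`, values `(a, ε)`: **Frobenius
congruences mod `7^s`** — at every finite place `v` of residue characteristic `ℓ` prime to `N`,
`σ` is unramified and `charpoly ι⁻¹σ(Frob_v) ≡ X³ − a(ℓ,1)X² + ℓ a(ℓ,2)X − ℓ³ ε(ℓ)` to precision
`7^{-s}` (arithmetic Frobenius; verbatim sub-term of the crux). [folklore] -/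
def FrobCongruentAtDepth [Fact (Nat.Prime 7)] (ι : PadicAlgCl 7 ≃+* ℂ) (σ : FramedGaloisRep ℚ ℂ 3)
    (s N : ℕ) (a : ℕ → ℕ → 𝒪) (ε : (ZMod N)ˣ → 𝒪) : Prop :=
  ∀ (v : IsDedekindDomain.HeightOneSpectrum (NumberField.RingOfIntegers ℚ)) (hv : Nat.Coprime v.residueCard N), σ.IsUnramifiedAt v ∧ ∀ P : Polynomial ℂ, σ.HasFrobCharpolyAt v P → ‖(P.map (ι.symm : ℂ →+* PadicAlgCl 7)).coeff 2 + (a v.residueCard 1 : PadicAlgCl 7)‖ ≤ (1 / 7 : ℝ) ^ s ∧ ‖(P.map (ι.symm : ℂ →+* PadicAlgCl 7)).coeff 1 - (v.residueCard : PadicAlgCl 7) * (a v.residueCard 2 : PadicAlgCl 7)‖ ≤ (1 / 7 : ℝ) ^ s ∧ ‖(P.map (ι.symm : ℂ →+* PadicAlgCl 7)).coeff 0 + (v.residueCard : PadicAlgCl 7) ^ 3 * (ε (ZMod.unitOfCoprime v.residueCard hv) : PadicAlgCl 7)‖ ≤ (1 / 7 : ℝ) ^ s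

/-- The crux's hypothesis, verbatim (= the conclusion of `SeptadicTorsionOccurrence`): **the
eigensystem of `ι⁻¹σ` occurs in torsion at EVERY `7`-adic depth** — for every `s ≥ 1` SOME level
`N_s > 0` and degree `i_s` carry a Hecke-algebra point mod `7^s` with the Frobenius congruences.
Level and degree are free to vary with `s`. [folklore] -/
def OccursInTorsionAtAllDepths [Fact (Nat.Prime 7)] (ι : PadicAlgCl 7 ≃+* ℂ)
    (σ : FramedGaloisRep ℚ ℂ 3) : Prop :=
  ∀ s : ℕ, 1 ≤ s → ∃ (N i : ℕ) (a : ℕ → ℕ → 𝒪) (ε : (ZMod N)ˣ → 𝒪), 0 < N ∧ IsHeckePointAtDepth s N i a ε ∧ FrobCongruentAtDepth ι σ s N a ε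

/-- **Occurrence at every depth AT A FIXED TAME LEVEL `N₀`**: as `OccursInTorsionAtAllDepths`, but
the level at depth `s` is `N₀ · 7^{r_s}` — only the power of `7` may grow with `s`.  This is the
finite-level shadow of "`ι⁻¹σ` is an `𝒪`-point of `Spf 𝕋(K^p)` for the tame level `K^p = K₁(N₀)`"
[cite: CalegariEmerton2011, §8] [cite: GeeNewton2020, §2.1.3]. -/
def OccursInTorsionAtTameLevel [Fact (Nat.Prime 7)] (ι : PadicAlgCl 7 ≃+* ℂ)
    (σ : FramedGaloisRep ℚ ℂ 3) (N₀ : ℕ) : Prop :=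
  ∀ s : ℕ, 1 ≤ s → ∃ (r i : ℕ) (a : ℕ → ℕ → 𝒪) (ε : (ZMod (N₀ * 7 ^ r))ˣ → 𝒪), IsHeckePointAtDepth s (N₀ * 7 ^ r) i a ε ∧ FrobCongruentAtDepth ι σ s (N₀ * 7 ^ r) a ε

/-- The crux's parity hypothesis, verbatim: `σ` is **of odd type** — every complex conjugation acts
non-trivially (`σ(c) ≠ 1`; for the centreless Klein image this forces `tr σ(c) = −1`). [folklore] -/
def OddType (σ : FramedGaloisRep ℚ ℂ 3) : Prop :=
  ∀ (φ : ℚ →+* ℝ) (c : Field.absoluteGaloisGroup ℚ), Literature.NumberTheory.GaloisRepresentations.IsComplexConjugation φ c → σ c ≠ 1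

/-- The crux's conclusion, verbatim: `σ` is **automorphic in Tunnell's a.e. sense** — an
L-algebraic cuspidal `π` on `GL₃(𝔸_ℚ)` whose Satake polynomial is the Frobenius polynomial of `σ`
at almost every finite place (the tree's `IsPiOfArtinRep` idiom, unfolded).
[cite: BuzzardGeeLMS2014, Conj. 3.2.2] -/
def AutomorphicAE (σ : FramedGaloisRep ℚ ℂ 3) : Prop :=
  ∃ (hcpt : Literature.NumberTheory.Automorphic.isCompact_glFiniteIntegralLevel 3 ℚ) (π : Literature.NumberTheory.Automorphic.CuspidalAutomorphicRepData 3 ℚ hcpt), π.1.IsLAlgebraic ∧ ∀ᶠ v : IsDedekindDomain.HeightOneSpectrum (NumberField.RingOfIntegers ℚ) in Filter.cofinite, ∃ α : Multiset ℂ, π.1.HasSatakeParamAt v α ∧ σ.IsUnramifiedAt v ∧ σ.HasFrobCharpolyAt v (Literature.NumberTheory.Automorphic.satakePolynomial α)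

/-! ## 1. The one notion the engine consumes: a continuous `ℚ̄₇`-point of the big Hecke algebra -/

/-- **`σ` is `ι`-pro-automorphic (7-adically automorphic) of tame level `𝒰`** on `GL₃/ℚ`: there is
a CONTINUOUS ring homomorphism `x : 𝕋(K^p) → ℚ̄₇` out of the completed-cohomology (big) Hecke
algebra of the `S`-good tame level `𝒰` (tree CONSTRUCTION `CompletedCohomologyHeckeAlgebraGLn 𝒰`:
the closed subring of `∏_{(r,s,i)} End H^i(X_{U_r}, ℤ/7^s)` topologically generated by the
spherical `T_{v,k}`, `v ∉ S`) with which `σ` is associated through `ι` at every good place: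
`σ` unramified at `v ∉ S` and `charpoly σ(Frob_v) = ι(X³ − x(T_{v,1})X² + q_v x(T_{v,2})X −
q_v³ x(T_{v,3}))` (arithmetic Frobenius; `BigHeckeGLn.heckeFrobPoly`).  This is
`TameLevel.IsPadicallyAutomorphic 𝒰 (ι⁻¹σ)` of the tree with the transport along the abstract field
isomorphism `ι` written on the polynomial instead of on `σ` (no `ι⁻¹σ : Γ_ℚ → GL₃(ℚ̄₇)` has to be
built) — Emerton's "pro-modular", Hansen's Def. 1.2.1 / Conj. 1.2.3 with the completed-cohomology
Hecke algebra in place of the eigenvariety, Gee–Newton's points of `𝕋^S(U^p)_𝔪`.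
[cite: HansenUniversalEigenvarieties2017, Def. 1.2.1 and Conj. 1.2.3] [cite: GeeNewton2020, §3.3, Def. 3.3.4] [cite: Emerton2006, §2.3] -/
def IsIotaProAutomorphic [Fact (Nat.Prime 7)] (ι : PadicAlgCl 7 ≃+* ℂ) (σ : FramedGaloisRep ℚ ℂ 3)
    (𝒰 : Literature.NumberTheory.Automorphic.BigHeckeGLn.TameLevel 3 ℚ 7) : Prop :=
  ∃ x : Literature.NumberTheory.Automorphic.CompletedCohomologyHeckeAlgebraGLn 𝒰 →+* PadicAlgCl 7, Continuous x ∧ ∀ v ∉ 𝒰.bad, σ.IsUnramifiedAt v ∧ σ.HasFrobCharpolyAt v ((Literature.NumberTheory.Automorphic.BigHeckeGLn.heckeFrobPoly 3 (Ideal.absNorm v.asIdeal) (fun k : ℕ => x (𝒰.heckeT v k))).map (ι : PadicAlgCl 7 →+* ℂ))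

/-- The crux, clause by clause (definitional unfolding of §0; certifies that the copies are
verbatim). [folklore] -/
theorem crux_iff : ArtinTorsionClassicalityGL3 ↔
    ∀ [Fact (Nat.Prime 7)] (ι : PadicAlgCl 7 ≃+* ℂ) (σ : FramedGaloisRep ℚ ℂ 3),
      σ.toGaloisRep.IsIrreducible → Finite ↥σ.toMonoidHom.range → OddType σ →
        OccursInTorsionAtAllDepths ι σ → AutomorphicAE σ :=
  Iff.rfl

/-! ## 2. The three stubs -/

/-- **STUB 1 — TAME LEVEL CONTROL (torsion level-lowering on `GL₃/ℚ` at every depth).**  If the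
eigensystem of `ι⁻¹σ` (`σ` irreducible with finite image) occurs in torsion at every `7`-adic depth
at SOME levels `N_s` (Hecke-algebra sense, Frobenius congruences mod `7^s` away from `N_s`), then it
does so at levels `N₀ · 7^{r_s}` for ONE `N₀ > 0`: the prime-to-`7` level can be frozen (expected:
`N₀ =` a multiple of the prime-to-`7` Artin conductor of `σ`, times `4` for the sign bookkeeping of
Stub 2).  Why plausibly true: it is the level-aspect half of "big `R = 𝕋_𝔪`" read at finite level —
`ι⁻¹σ mod 7^s` is a point of the universal deformation ring unramified outside `cond(σ)·7`, so
occurrence should already happen at tame level `cond(σ)` (Calegari–Geraghty / Gee–Newton in defect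
`l₀ = 1`); for `GL₂` it is Ribet/Diamond–Taylor level-lowering and its mod-`p^s` refinements.  Why it
might fail: no level-lowering theorem for TORSION eigensystems of `SL₃(ℤ)`-congruence subgroups is
known (not even mod `7`), the auxiliary primes in `N_s` may be level-RAISING primes whose removal
costs depth, and the hypothesis only sees each depth separately (no compatibility between the
classes at different `s`).  Size: open-problem (level aspect), the cheapest of the three to attack
computationally (Voronoi/sharbly homology of `Γ₁(3^a·7^r)` for the Trinks field, route header).
Leans on: `SLn.heckeT`, `SLn.diamondOp`, `SLn.Gamma1` (tree, `TorsionHeckeEigensystem`).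
[cite: CalegariGeraghty2017, §1 and Conj. B] [cite: GeeNewton2020, §3.3] [cite: Ribet1990, Thm. 1.1] [cite: CalegariVenkatesh2019, Ch. 1] -/
theorem stub_tameLevelControl [Fact (Nat.Prime 7)]
    (ι : PadicAlgCl 7 ≃+* ℂ)
    (σ : FramedGaloisRep ℚ ℂ 3)
    (hirr : σ.toGaloisRep.IsIrreducible)
    (hfin : Finite ↥σ.toMonoidHom.range)
    (hocc : OccursInTorsionAtAllDepths ι σ) :
    ∃ N₀ : ℕ, 0 < N₀ ∧ OccursInTorsionAtTameLevel ι σ N₀ := by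
  sorry

/-- **STUB 2 — FROM TORSION AT ALL DEPTHS TO A CONTINUOUS POINT OF `𝕋(K^p)` (comparison +
passage to the limit).**  Fixed-tame-level occurrence at every depth (Stub 1's output, in the
`SL₃(ℤ)`/`Γ₁(N₀·7^r)` language of the crux) makes `σ` `ι`-pro-automorphic of SOME `S`-good tame
level `𝒰` of `GL₃/ℚ` (`IsIotaProAutomorphic`): the assignment `T_{v,k} ↦ ι⁻¹`(Frobenius data of
`σ`) extends to a continuous ring map `𝕋(K^p) → ℚ̄₇`.  Proof plan (theorem-sized, every step in
print): (a) `H^i(Γ₁(M) ⊂ SL₃(ℤ), A) = H^i(X_U, A)` for `U = K₁(M) ∩ {det ≡ 1 mod 4} ≤ GL₃(ℤ̂)`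
(strong approximation for `SL₃`, class number one since `{±1}·(1+4ℤ₂) = ℤ₂ˣ`, `GL₃(ℚ) ∩ U = Γ₁(M)`
because `−1 ≢ 1 mod 4`), with `T(ℓ,k) ↔ [U diag(ℓ_v^{(k)},1) U]` up to the outer involution
`diag(−1,1,1)` at `ℓ ≡ 3 mod 4` (a `χ₋₄`-twist on one `±`-eigenspace, absorbed into the choice of `𝒰`
and `2 ∈ S`) and `⟨ℓ⟩·T(ℓ,3) ↔ T_{v,3}`; (b) flat base change `ℤ/7^s → 𝒪/7^s` (`𝒪` torsion-free over
`ℤ₇`, `Γ₁` of type `FP_∞`); (c) Hochschild–Serre from the principal `7`-power tower `U_r ◁ K₁(7^r)`-levels: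
a relation among the `T_{v,k}` vanishing on all `H^b(X_{U_r}, ℤ/7^s)` acts NILPOTENTLY of echelon
`≤ 7` on `H^i(Γ₁(N₀7^r), 𝒪/7^s)`, so the `𝒪/7^s`-point kills it to precision `7^{s/7}` — enough, all
depths being available; (d) the values `x(T_{v,k})` lie in `ι⁻¹ℚ(tr σ) ⊂ E`, `E/ℚ₇` finite (finite
image), so the uniformly continuous `x` on the dense image of `𝕋^S` extends to the closure with values
in `𝒪_E ⊂ ℚ̄₇`.  Why it might fail (as typed): only bookkeeping — the `k ↔ 3−k` / `π ↦ π^∨` reading of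
`T(ℓ,k)` on cohomology (fixed by the crux's own normalisation `X³ − a₁X² + ℓa₂X − ℓ³ε`, consistent
with `(X−1)(X−ℓ)(X−ℓ²)` on `H⁰`), and the sign character at `2`.  Size: L.  Leans on:
`BigHeckeGLn.TameLevel`, `CompletedCohomologyHeckeAlgebraGLn`, `TameLevel.heckeT`,
`BigHeckeGLn.heckeFrobPoly`, `levelCohomologyIso` (tree), Mathlib `groupCohomology`.
[cite: CalegariEmerton2011, §8] [cite: Scholze2015, Thm. V.4.1 and Rem. V.4.5] [cite: GeeNewton2020, §2.1.3, Def. 2.1.5, Lemma 2.1.8] [cite: AshGunnellsMcconnell2011, §3] -/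
theorem stub_completedCohomologyPoint [Fact (Nat.Prime 7)]
    (ι : PadicAlgCl 7 ≃+* ℂ)
    (σ : FramedGaloisRep ℚ ℂ 3)
    (hfin : Finite ↥σ.toMonoidHom.range)
    (N₀ : ℕ)
    (hN₀ : 0 < N₀)
    (hocc : OccursInTorsionAtTameLevel ι σ N₀) :
    ∃ 𝒰 : Literature.NumberTheory.Automorphic.BigHeckeGLn.TameLevel 3 ℚ 7, IsIotaProAutomorphic ι σ 𝒰 := by
  sorry

/-- **STUB 3 — ARTIN-TYPE POINTS OF `𝕋(K^p)` ON `GL₃/ℚ` ARE CLASSICAL (the archimedean wall,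
Fontaine–Mazur on the Hecke side).**  An irreducible, finite-image, ODD-type `σ : Γ_ℚ → GL₃(ℂ)`
which is `ι`-pro-automorphic of some `S`-good tame level `𝒰` (a continuous `ℚ̄₇`-point of the
completed-cohomology Hecke algebra of `GL₃/ℚ` associated with `σ`) is automorphic: an L-algebraic
cuspidal `π` on `GL₃(𝔸_ℚ)` with Satake = Frobenius a.e. (expected `π_∞` = tempered principal series
of signs `(1, sgn, sgn)` at infinitesimal character `0`, i.e. weight `(0,0,0) = −ρ`).  This is the
hardest stub and carries every risk named in the crux's why-it-might-fail: weight `−ρ` is not an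
algebraic weight, `GL₃/ℚ` has no Shimura/coherent receptacle, `σ` non-self-dual ⇒ classical
(regular) points are not expected to accumulate at `x_σ` (Ash–Pollack–Stevens Conj. 0.1,
Calegari–Mazur), so no overconvergent-to-classical or family argument is available; the GL₂/ℚ
analogue is weight-one classicality of pro-modular points (Buzzard–Taylor, Pan).  Handles: Hansen's
`GL_n` eigenvariety through `x_σ` (Newton's dimension bound `≥ dim 𝒲 − l(x)`), Sen/infinitesimal
character of the `σ`-part of completed cohomology, local–global compatibility at `7` for torsion.
True if Fontaine–Mazur–Langlands (B) holds for `n = 3` over `ℚ` (finite image ⇒ de Rham).  Why the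
extra hypothesis is not decoration: without pro-automorphy this is the whole odd rank-3 Artin sector
of the summit; with it, it is a `7`-adic classicality statement at a non-cohomological weight.
Size: open-problem.  Leans on: `IsIotaProAutomorphic` (§1), `CuspidalAutomorphicRepData`,
`HasSatakeParamAt`, `satakePolynomial` (tree).
[cite: FontaineMazurGeometric1995, Conj. 1] [cite: HansenUniversalEigenvarieties2017, Conj. 1.2.3 and Thm. 1.1.6] [cite: AshPollackStevens2007, Conj. 0.1] [cite: CalegariMazur2008, §1] [cite: Calegari2023, §12] -/
theorem stub_artinPointClassical [Fact (Nat.Prime 7)]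
    (ι : PadicAlgCl 7 ≃+* ℂ)
    (σ : FramedGaloisRep ℚ ℂ 3)
    (hirr : σ.toGaloisRep.IsIrreducible)
    (hfin : Finite ↥σ.toMonoidHom.range)
    (hodd : OddType σ)
    (𝒰 : Literature.NumberTheory.Automorphic.BigHeckeGLn.TameLevel 3 ℚ 7)
    (hpro : IsIotaProAutomorphic ι σ 𝒰) :
    AutomorphicAE σ := by
  sorry

/-! ## 3. The stub statements as named `Prop`s (literally the types of the stubs; no `sorry` inherited) -/

namespace _Goal

/-- The statement of `stub_tameLevelControl`, as a named `Prop` (literally its type). [folklore] -/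
def stub_tameLevelControl : Prop :=
  type_of% @Summit.Langlands.Langlands.Cruxes.ArtinTorsionClassicalityGL3.Birth.stub_tameLevelControl

/-- The statement of `stub_completedCohomologyPoint`, as a named `Prop` (literally its type). [folklore] -/
def stub_completedCohomologyPoint : Prop :=
  type_of% @Summit.Langlands.Langlands.Cruxes.ArtinTorsionClassicalityGL3.Birth.stub_completedCohomologyPoint

/-- The statement of `stub_artinPointClassical`, as a named `Prop` (literally its type). [folklore] -/
def stub_artinPointClassical : Prop :=
  type_of% @Summit.Langlands.Langlands.Cruxes.ArtinTorsionClassicalityGL3.Birth.stub_artinPointClassical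

end _Goal

/-! ## 4. The composition (kernel-checked, no `sorry`): LEVEL CONTROL → `𝕋(K^p)`-POINT → CLASSICALITY → crux by name -/

/-- **The crux from the three stubs.**  Given the crux data (`ι`, an irreducible finite-image odd
`σ`, torsion occurrence at every depth): STUB 1 freezes the tame level to some `N₀`; STUB 2 turns
fixed-tame-level occurrence at all depths into a continuous `ℚ̄₇`-point of the completed-cohomology
Hecke algebra of some tame level `𝒰` with which `σ` is `ι`-associated; STUB 3 (the archimedean
wall) makes such an Artin-type point classical.  Hypotheses are, by name, the statements of the
three stubs; the conclusion is the route decl `ArtinTorsionClassicalityGL3`. [folklore] -/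
theorem ArtinTorsionClassicalityGL3_of (h₁ : _Goal.stub_tameLevelControl)
    (h₂ : _Goal.stub_completedCohomologyPoint) (h₃ : _Goal.stub_artinPointClassical) :
    ArtinTorsionClassicalityGL3 := by
  -- read the three named statements
  have hLevel : ∀ [Fact (Nat.Prime 7)] (ι : PadicAlgCl 7 ≃+* ℂ) (σ : FramedGaloisRep ℚ ℂ 3),
      σ.toGaloisRep.IsIrreducible → Finite ↥σ.toMonoidHom.range →
        OccursInTorsionAtAllDepths ι σ → ∃ N₀ : ℕ, 0 < N₀ ∧ OccursInTorsionAtTameLevel ι σ N₀ := h₁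
  have hPoint : ∀ [Fact (Nat.Prime 7)] (ι : PadicAlgCl 7 ≃+* ℂ) (σ : FramedGaloisRep ℚ ℂ 3),
      Finite ↥σ.toMonoidHom.range → ∀ N₀ : ℕ, 0 < N₀ → OccursInTorsionAtTameLevel ι σ N₀ →
        ∃ 𝒰 : Literature.NumberTheory.Automorphic.BigHeckeGLn.TameLevel 3 ℚ 7,
          IsIotaProAutomorphic ι σ 𝒰 := h₂
  have hClassical : ∀ [Fact (Nat.Prime 7)] (ι : PadicAlgCl 7 ≃+* ℂ) (σ : FramedGaloisRep ℚ ℂ 3),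
      σ.toGaloisRep.IsIrreducible → Finite ↥σ.toMonoidHom.range → OddType σ →
        ∀ 𝒰 : Literature.NumberTheory.Automorphic.BigHeckeGLn.TameLevel 3 ℚ 7,
          IsIotaProAutomorphic ι σ 𝒰 → AutomorphicAE σ := h₃
  -- the crux, clause by clause
  rw [crux_iff]
  intro hp ι σ hirr hfin hodd hocc
  -- STUB 1: freeze the tame level
  obtain ⟨N₀, hN₀, hlev⟩ := @hLevel hp ι σ hirr hfin hocc
  -- STUB 2: a continuous `ℚ̄₇`-point of `𝕋(K^p)` associated with `σ` through `ι`
  obtain ⟨𝒰, hpro⟩ := @hPoint hp ι σ hfin N₀ hN₀ hlev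
  -- STUB 3: Artin-type points are classical
  exact @hClassical hp ι σ hirr hfin hodd 𝒰 hpro

/-- By-name sanity check (an `example`, so it is not a declaration of the file): the three stubs feed
the composition as they stand. -/
example : ArtinTorsionClassicalityGL3 :=
  ArtinTorsionClassicalityGL3_of @stub_tameLevelControl @stub_completedCohomologyPoint
    @stub_artinPointClassical

end Summit.Langlands.Langlands.Cruxes.ArtinTorsionClassicalityGL3.Birth

end
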